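import Literature.Analysis.FunctionSpaces.ItoFormulaProofs
import Literature.Analysis.FunctionSpaces.ItoIntegralLocalization
import Literature.Probability.Process.ItoIntegralLocality
import HarnessLib

/-!
# Itô's formula for the canonical Brownian motion: discharge of `Literature.Probability.Process.ito_formula`

Second sibling proof file of `Literature/Probability/Process/ItoCalculus.lean` (the first,
`ItoCalculusProofs.lean`, proves the Itô isometry for simple integrands and the basic u.c.p.
estimate, and sits *below* the Itô-formula machinery in the import graph, so the present
discharge cannot be appended there). It proves, without `sorry`, the named fact
`Literature.Probability.Process.ito_formula` of that file — Itô's formula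
`f(Bₜ) = f(0) + ∫₀ᵗ f'(B_s) dB_s + ½ ∫₀ᵗ f''(B_s) ds` for `f ∈ C²(ℝ)` and the canonical Brownian
motion `B = Literature.Probability.Process.brownian` (raw natural filtration
`Literature.Probability.RandomPlanarGeometry.brownianFiltration`, pre-Wiener measure) — as the
special case `X = B` (drift `b = 0`, diffusion coefficient `σ = 1`, `f` independent of `t`) of the
tree's proved Itô formula for Itô processes in integrated form,
`Literature.Analysis.FunctionSpaces.ito_formula_itoProcess_ae_of` (`ItoFormulaProofs.lean`,
Taylor-expansion proof of Le Gall, Thm 5.10 / Revuz–Yor, Ch. IV, Thm (3.3)):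

* `isItoProcess_brownian`: `B` is an Itô process with `b = 0`, `σ = 1`, because `∫ 1 dB = B`
  (`Literature.Probability.Process.isItoIntegral_const_brownian`);
* `ito_formula_ae_of_isItoIntegral`: for *any* Itô integral `K = ∫ f'(B) dB`, almost surely,
  for all `t`, `f(Bₜ) = f(0) + Kₜ + ½ ∫₀ᵗ f''(B_s) ds` (the drift of the general formula reduces
  to `½ f''`, and the interval integral `∫ in 0..t` is the set integral over `[0, t]`);
* `ito_formula_holds`: such a `K` exists by the proved existence fact
  `Literature.Analysis.FunctionSpaces.exists_isItoIntegral_holds` (through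
  `exists_isItoIntegral_mul_of_continuous`: `f'(B)` is adapted with continuous paths).

Nothing is constructed anew and no new fact is introduced.

## References

* K. Itô, *Stochastic integral*, Proc. Imp. Acad. Tokyo 20 (1944), 519–524; *On a formula
  concerning stochastic differentials*, Nagoya Math. J. 3 (1951), 55–65.
* D. Revuz, M. Yor, *Continuous Martingales and Brownian Motion* (3rd ed., 1999), Ch. IV,
  Thm (3.3) (Itô's formula) and Prop. (1.14)/(2.10) (`⟨B⟩ₜ = t`, `∫ 1 dB = B`).
* J.-F. Le Gall, *Brownian Motion, Martingales, and Stochastic Calculus* (2016), Thm 5.10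
  (p. 113: `F(X_t) = F(X_0) + ∫₀ᵗ F'(X_s) dX_s + ½ ∫₀ᵗ F''(X_s) d⟨X, X⟩_s`).
-/

open MeasureTheory ProbabilityTheory Filter
open scoped NNReal ENNReal Topology

noncomputable section

namespace Literature.Probability.Process

open Literature.Analysis.FunctionSpaces Literature.Probability.RandomPlanarGeometry

/-- **Brownian motion is an Itô process** with drift `0` and diffusion coefficient `1`:
`B = B₀ + ∫₀ 0 ds + ∫₀ 1 dB`, the Itô integral of the constant `1` being `B` itself
(`isItoIntegral_const_brownian 1`, and `B₀ = 0`).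
Revuz–Yor, *Continuous Martingales and Brownian Motion* (1999), Ch. IV, §3 (before Thm (3.3))
and Prop. (2.10)(i). [folklore] -/
theorem isItoProcess_brownian :
    IsItoProcess brownian (fun _ _ ↦ 0) (fun _ _ ↦ 1) brownian brownianFiltration
      preWienerMeasure := by
  refine ⟨ae_of_all _ fun ω t ↦ integrableOn_zero, fun t ω ↦ 1 * brownian t ω,
    isItoIntegral_const_brownian 1, ae_of_all _ fun ω t ↦ ?_⟩
  simp

/-- **Itô's formula for `f(B)`, given the stochastic integral**: if `f ∈ C²(ℝ)` and `K` is an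
Itô integral `∫₀ f'(B_s) dB_s` of `f'(B)` against the canonical Brownian motion (in the sense of
`IsItoIntegral`), then almost surely, for all `t`,
`f(Bₜ) = f(0) + Kₜ + ½ ∫₀ᵗ f''(B_s) ds`. This is the case `X = B` (`b = 0`, `σ = 1`,
`f` independent of time) of the tree's Itô formula for Itô processes
`Literature.Analysis.FunctionSpaces.ito_formula_itoProcess_ae_of`: the drift
`∂ₜf + b ∂ₓf + ½ σ² ∂ₓₓf` reduces to `½ f''(B_s)`, and `∫ in 0..t` over Lebesgue measure is the
integral over `[0, t]`.
Revuz–Yor, *Continuous Martingales and Brownian Motion* (1999), Ch. IV, Thm (3.3);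
Le Gall (2016), Thm 5.10. [cite: RevuzYor1999, Ch. IV Thm (3.3)] -/
theorem ito_formula_ae_of_isItoIntegral {f : ℝ → ℝ} (hf : ContDiff ℝ 2 f)
    {K : ℝ≥0 → (ℝ≥0 → ℝ) → ℝ}
    (hK : IsItoIntegral (fun t ω ↦ deriv f (brownian t ω)) brownian K brownianFiltration
      preWienerMeasure) :
    ∀ᵐ ω ∂preWienerMeasure, ∀ t : ℝ≥0,
      f (brownian t ω) = f 0 + K t ω +
        (1 / 2) * ∫ s in Set.Icc (0 : ℝ) t, iteratedDeriv 2 f (brownian s.toNNReal ω) := by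
  -- `f` as a time-independent function of two variables
  have hg2 : ContDiff ℝ 2 (Function.uncurry fun (_ : ℝ) (x : ℝ) ↦ f x) :=
    hf.comp contDiff_snd
  -- the integrand `σ ∂ₓf(t, Xₜ)` of the general formula is `1 * f'(Bₜ) = f'(Bₜ)`
  have hK' : IsItoIntegral
      (fun t ω ↦ (fun (_ : ℝ≥0) (_ : ℝ≥0 → ℝ) ↦ (1 : ℝ)) t ω *
        deriv ((fun (_ : ℝ) (x : ℝ) ↦ f x) t) (brownian t ω))
      brownian K brownianFiltration preWienerMeasure :=
    hK.congr_integrand_ae (ae_of_all _ fun ω t ↦ by simp)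
  have h := ito_formula_itoProcess_ae_of hg2 adapted_brownian
    (isStronglyProgressive_const _ (1 : ℝ)) isItoProcess_brownian hK'
  filter_upwards [h] with ω hω t
  have ht := hω t
  simp only [deriv_const, zero_add, zero_mul, one_pow, mul_one, brownian_zero,
    Pi.zero_apply] at ht
  rw [ht, intervalIntegral.integral_const_mul, intervalIntegral.integral_of_le t.coe_nonneg,
    integral_Icc_eq_integral_Ioc]
  ring

/-- **Itô's formula for the canonical Brownian motion holds** (discharge of the named fact
`Literature.Probability.Process.ito_formula`): for `f ∈ C²(ℝ)` there is an Itô integral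
`J = ∫₀ f'(B_s) dB_s` (from the proved existence fact `exists_isItoIntegral`, the integrand
`f'(B)` being adapted with continuous paths: `exists_isItoIntegral_mul_of_continuous` with
`σ = 1`), and for every such `J`, almost surely, for all `t`,
`f(Bₜ) = f(0) + Jₜ + ½ ∫₀ᵗ f''(B_s) ds` (`ito_formula_ae_of_isItoIntegral`).
K. Itô (1944, 1951); Revuz–Yor, *Continuous Martingales and Brownian Motion* (1999), Ch. IV,
Thm (3.3); Le Gall (2016), Thm 5.10. [cite: RevuzYor1999, Ch. IV Thm (3.3)] -/
theorem ito_formula_holds : ito_formula := by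
  intro f hf
  have hg1 : ContDiff ℝ 1 (Function.uncurry fun (_ : ℝ) (x : ℝ) ↦ f x) :=
    (hf.comp contDiff_snd).of_le (by norm_num)
  obtain ⟨K, hK⟩ := exists_isItoIntegral_mul_of_continuous exists_isItoIntegral_holds
    (isStronglyProgressive_const _ (1 : ℝ)) (isItoIntegral_const_brownian 1)
    (adapted_deriv_apply hg1 adapted_brownian)
    (isItoProcess_brownian.ae_continuous_deriv_apply hg1)
  have hK' : IsItoIntegral (fun t ω ↦ deriv f (brownian t ω)) brownian K brownianFiltration
      preWienerMeasure :=
    hK.congr_integrand_ae (ae_of_all _ fun ω t ↦ by simp)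
  exact ⟨K, hK', ito_formula_ae_of_isItoIntegral hf hK'⟩

end Literature.Probability.Process
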